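import Summits.NavierStokesRegularity.FluidComputer.AngularGalerkinLadderBasics
import Summits.NavierStokesRegularity.FluidComputer.AngularGalerkinLadderLinearFlows
import Literature.Analysis.FluidPDE.CurlIsometryCovariance

/-!
# The angular Galerkin ladder: rotations (and reflections) about the centre commute with the
# Casimir cut; every rung keeps the exact rotation symmetry of Navier–Stokes (theorems only)

Cell `ns-blowup`, seat `ns-blowup-lean` (g10). LABEL: KERNEL typing hygiene for the vocabulary of
`FluidComputer/AngularGalerkinLadder.lean` (route `Theses/AngularGalerkinLadder.lean`). WHAT THIS IS
NOT: not Navier–Stokes evidence — kinematic identities about the rotation generators and the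
Casimir cut and the bookkeeping of the rotation symmetry on the typed rung classes; nothing is
asserted about blow-up or about the dynamics of any rung, no profile is constructed.

## Content

For a linear isometry `R` of `ℝ³ = EuclideanSpace ℝ (Fin 3)` (`det R = ±1`) and a vector field
`u`, write `ρ(R)u = R ∘ u ∘ R⁻¹`.

§1 **The cross product is a pseudo-vector**: `R a × R b = det R • R(a × b)`
(`cross_map_linearIsometryEquiv`), from the universal `3 × 3` identity
`Ma × Mb = adj(M)ᵀ (a × b)` and `adj(M) = det M · Mᵀ` for orthogonal `M`.

§2 `J_v := v × (·) − ∂_{v × x}` is linear in `v`: `Σ_i v_i J_{e_i} u = v × u − Du(v × x)`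
(`sum_smul_angGen`); and **the generators are conjugated among themselves**:
`J_a (ρ(R)u)(x) = det R • R (Σ_i (R⁻¹e_a)_i (J_i u)(R⁻¹x))` (`angGen_conj_linearIsometryEquiv`).

§3 **The Casimir commutes with `ρ(R)`** for smooth `u`: `𝒞(ρ(R)u) = ρ(R)(𝒞u)`
(`casimir_conj_linearIsometryEquiv`; the sign `det R` enters squared, and
`Σ_a (R⁻¹e_a)_i (R⁻¹e_a)_j = δ_ij` re-assembles `Σ_a J_a²`) — so do the band defects, and
**`IsBandLimited L` is invariant under every rotation and reflection about the centre**
(`IsBandLimited.conj_linearIsometryEquiv`); dually `IsCobandLimited.conj_linearIsometryEquiv`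
(isometries preserve Lebesgue measure).

§4 **Every rung keeps the rotation symmetry of Navier–Stokes**:
`IsRungSolutionOn.conj_linearIsometryEquiv` — `(ρ(R)u, p ∘ R⁻¹, ρ(R)d)` is a rung-`L` solution
whenever `(u, p, d)` is (on a time set of unique differentiability), the classical part being the
tree's `IsClassicalNSSolutionOn.conj_linearIsometryEquiv` (Majda–Bertozzi Prop. 1.1 (iii) with
force).

With `AngularGalerkinLadderScaling` (dilations) and `AngularGalerkinLadderRadialCutoff` (radial
multipliers) this completes the kinematic covariance of the cut under the symmetry group used by
the route's rotated-DSS profiles.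

References: [cite: MajdaBertozziCUP2002, §1.2 Prop. 1.1] (rotation symmetry);
[cite: ArfkenWeber1995, §2.9 eq. (2.90)] (pseudo-vectors); [cite: BullardGellman1954] (isotypic
cut);
[cite: ChaeWolf2017, Def. 1.1] (rotated DSS).
-/

noncomputable section

namespace Summit.NavierStokesRegularity.FluidComputer

open Set MeasureTheory Filter Topology Function Matrix
open scoped ContDiff RealInnerProductSpace
open Literature.Analysis.FluidPDE

namespace AngularLadder

variable {u g : EuclideanSpace ℝ (Fin 3) → EuclideanSpace ℝ (Fin 3)} {L : ℕ}

/-! ## §1 The cross product is a pseudo-vector under linear isometries -/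

/-- The universal `3 × 3` identity `(Ma) × (Mb) = adj(M)ᵀ (a × b)` (the cross product of two
columns of `M` is a column of its cofactor matrix). [folklore] -/
private theorem crossProduct_mulVec (M : Matrix (Fin 3) (Fin 3) ℝ) (a b : Fin 3 → ℝ) :
    (M *ᵥ a) ⨯₃ (M *ᵥ b) = (M.adjugate)ᵀ *ᵥ (a ⨯₃ b) := by
  rw [Matrix.adjugate_fin_three]
  ext i
  fin_cases i <;>
    simp [cross_apply, Matrix.mulVec, dotProduct, Fin.sum_univ_three, Matrix.transpose_apply] <;>
    ring

/-- For an orthogonal `3 × 3` matrix (`Mᵀ M = 1`), `adj(M) = det M · Mᵀ`. [folklore] -/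
private theorem adjugate_eq_of_transpose_mul_eq_one {M : Matrix (Fin 3) (Fin 3) ℝ}
    (hM : Mᵀ * M = 1) : M.adjugate = M.det • Mᵀ := by
  have h := Matrix.mul_adjugate M
  calc M.adjugate = (Mᵀ * M) * M.adjugate := by rw [hM, Matrix.one_mul]
    _ = Mᵀ * (M * M.adjugate) := by rw [Matrix.mul_assoc]
    _ = M.det • Mᵀ := by rw [h, Matrix.mul_smul, Matrix.mul_one]

/-- The determinant of the standard matrix is the determinant of the operator (plumbing; the
tree's copy in `CurlIsometryCovariance` is private). [folklore] -/
private theorem det_toMatrixOrthonormal_basisFun'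
    (T : EuclideanSpace ℝ (Fin 3) →L[ℝ] EuclideanSpace ℝ (Fin 3)) :
    (LinearMap.toMatrixOrthonormal (EuclideanSpace.basisFun (Fin 3) ℝ)
        (T : EuclideanSpace ℝ (Fin 3) →ₗ[ℝ] EuclideanSpace ℝ (Fin 3))).det = T.det := by
  rw [Literature.Analysis.Calculus.toMatrixOrthonormal_basisFun_eq_toMatrix, LinearMap.det_toMatrix]

/-- Coordinates of the image under a linear isometry: `(R w)_i = ([R] w)_i` with `[R]` the
standard matrix. [folklore] -/
private theorem ofLp_map_eq_mulVec
    (R : EuclideanSpace ℝ (Fin 3) ≃ₗᵢ[ℝ] EuclideanSpace ℝ (Fin 3)) (w : EuclideanSpace ℝ (Fin 3)) :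
    (fun i => R w i) =
      LinearMap.toMatrixOrthonormal (EuclideanSpace.basisFun (Fin 3) ℝ)
        ((R : EuclideanSpace ℝ (Fin 3) →L[ℝ] EuclideanSpace ℝ (Fin 3)) :
          EuclideanSpace ℝ (Fin 3) →ₗ[ℝ] EuclideanSpace ℝ (Fin 3)) *ᵥ (fun k => w k) := by
  funext i
  exact Literature.Analysis.Calculus.apply_apply_eq_toMatrixOrthonormal_mulVec
    (R : EuclideanSpace ℝ (Fin 3) →L[ℝ] EuclideanSpace ℝ (Fin 3)) w i

/-- **The cross product is a pseudo-vector**: for a linear isometry `R` of `ℝ³`,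
`R a × R b = det R • R (a × b)` (`det R = ±1`; Arfken–Weber (2.90)).
[cite: ArfkenWeber1995, §2.9 eq. (2.90)] -/
theorem cross_map_linearIsometryEquiv
    (R : EuclideanSpace ℝ (Fin 3) ≃ₗᵢ[ℝ] EuclideanSpace ℝ (Fin 3))
    (a b : EuclideanSpace ℝ (Fin 3)) :
    cross (R a) (R b) =
      (R : EuclideanSpace ℝ (Fin 3) →L[ℝ] EuclideanSpace ℝ (Fin 3)).det • R (cross a b) := by
  set M := LinearMap.toMatrixOrthonormal (EuclideanSpace.basisFun (Fin 3) ℝ)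
    ((R : EuclideanSpace ℝ (Fin 3) →L[ℝ] EuclideanSpace ℝ (Fin 3)) :
      EuclideanSpace ℝ (Fin 3) →ₗ[ℝ] EuclideanSpace ℝ (Fin 3)) with hM
  have hMM : Mᵀ * M = 1 := toMatrixOrthonormal_transpose_mul_eq_one R
  have hdet : (R : EuclideanSpace ℝ (Fin 3) →L[ℝ] EuclideanSpace ℝ (Fin 3)).det = M.det :=
    (det_toMatrixOrthonormal_basisFun' _).symm
  have hadj : (M.adjugate)ᵀ = M.det • M := by
    rw [adjugate_eq_of_transpose_mul_eq_one hMM, Matrix.transpose_smul, Matrix.transpose_transpose]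
  apply PiLp.ext
  intro i
  have ha : (fun k => R a k) = M *ᵥ fun k => a k := ofLp_map_eq_mulVec R a
  have hb : (fun k => R b k) = M *ᵥ fun k => b k := ofLp_map_eq_mulVec R b
  have hc : (fun k => R (cross a b) k) = M *ᵥ fun k => cross a b k := ofLp_map_eq_mulVec R _
  -- left-hand side in coordinates
  have hl : cross (R a) (R b) i = ((fun k => R a k) ⨯₃ (fun k => R b k)) i := rfl
  have hr : (R (cross a b)) i = (fun k => R (cross a b) k) i := rfl
  have hcab : (fun k => cross a b k) = (fun k => a k) ⨯₃ (fun k => b k) := rfl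
  rw [hl, ha, hb, crossProduct_mulVec, hadj, PiLp.smul_apply, hr, hc, hcab, Matrix.smul_mulVec,
    Pi.smul_apply, hdet]

/-- `det R⁻¹ = det R` for a linear isometry of `ℝ³` (both are `±1` with product `1`). [folklore] -/
theorem det_symm_eq_det (R : EuclideanSpace ℝ (Fin 3) ≃ₗᵢ[ℝ] EuclideanSpace ℝ (Fin 3)) :
    (R.symm : EuclideanSpace ℝ (Fin 3) →L[ℝ] EuclideanSpace ℝ (Fin 3)).det =
      (R : EuclideanSpace ℝ (Fin 3) →L[ℝ] EuclideanSpace ℝ (Fin 3)).det := by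
  have hprod : (R.symm : EuclideanSpace ℝ (Fin 3) →L[ℝ] EuclideanSpace ℝ (Fin 3)).det *
      (R : EuclideanSpace ℝ (Fin 3) →L[ℝ] EuclideanSpace ℝ (Fin 3)).det = 1 := by
    rw [ContinuousLinearMap.det, ContinuousLinearMap.det, ← LinearMap.det_comp]
    have : ((R.symm : EuclideanSpace ℝ (Fin 3) →L[ℝ] EuclideanSpace ℝ (Fin 3)) :
        EuclideanSpace ℝ (Fin 3) →ₗ[ℝ] EuclideanSpace ℝ (Fin 3)) ∘ₗ
        ((R : EuclideanSpace ℝ (Fin 3) →L[ℝ] EuclideanSpace ℝ (Fin 3)) :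
          EuclideanSpace ℝ (Fin 3) →ₗ[ℝ] EuclideanSpace ℝ (Fin 3)) = LinearMap.id := by
      apply LinearMap.ext
      intro x
      simp
    rw [this, LinearMap.det_id]
  rcases det_linearIsometryEquiv_eq_one_or_eq_neg_one R with h | h
  · rw [h, mul_one] at hprod
    rw [hprod, h]
  · rw [h] at hprod ⊢
    linarith

/-- The pseudo-vector law read through `R⁻¹`: `R⁻¹ (a × b) = det R • (R⁻¹a × R⁻¹b)`. [folklore] -/
theorem symm_cross_eq (R : EuclideanSpace ℝ (Fin 3) ≃ₗᵢ[ℝ] EuclideanSpace ℝ (Fin 3))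
    (a b : EuclideanSpace ℝ (Fin 3)) :
    R.symm (cross a b) =
      (R : EuclideanSpace ℝ (Fin 3) →L[ℝ] EuclideanSpace ℝ (Fin 3)).det •
        cross (R.symm a) (R.symm b) := by
  have h := cross_map_linearIsometryEquiv R.symm a b
  rw [det_symm_eq_det] at h
  rw [h, smul_smul, det_linearIsometryEquiv_mul_self, one_smul]

/-- The pseudo-vector law with one rotated factor: `a × R z = det R • R (R⁻¹a × z)`. [folklore] -/
theorem cross_map_right (R : EuclideanSpace ℝ (Fin 3) ≃ₗᵢ[ℝ] EuclideanSpace ℝ (Fin 3))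
    (a z : EuclideanSpace ℝ (Fin 3)) :
    cross a (R z) =
      (R : EuclideanSpace ℝ (Fin 3) →L[ℝ] EuclideanSpace ℝ (Fin 3)).det •
        R (cross (R.symm a) z) := by
  have h := cross_map_linearIsometryEquiv R (R.symm a) z
  rwa [LinearIsometryEquiv.apply_symm_apply] at h

/-! ## §2 The generators: linearity in the axis and conjugation by isometries -/

/-- Expansion of the cross product along the axes: `v × z = Σ_i v_i (e_i × z)`. [folklore] -/
theorem cross_eq_sum_axis (v z : EuclideanSpace ℝ (Fin 3)) :
    cross v z = ∑ i : Fin 3, v i • cross (axis i) z := by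
  rw [Fin.sum_univ_three]
  apply PiLp.ext
  intro j
  fin_cases j <;> simp [cross, cross_apply, axis_apply] <;> ring

/-- **`J_v = Σ_i v_i J_{e_i}`**: for every `v`,
`Σ_i v_i (J_i u)(x) = v × u(x) − Du(x)(v × x)`. [folklore] -/
theorem sum_smul_angGen (u : EuclideanSpace ℝ (Fin 3) → EuclideanSpace ℝ (Fin 3))
    (v x : EuclideanSpace ℝ (Fin 3)) :
    ∑ i : Fin 3, v i • angGen i u x = cross v (u x) - fderiv ℝ u x (cross v x) := by
  simp only [angGen, smul_sub, Finset.sum_sub_distrib, ← map_smul, ← map_sum,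
    ← cross_eq_sum_axis]

/-- **Conjugation of the generators by a linear isometry**:
`J_a(R ∘ u ∘ R⁻¹)(x) = det R • R (Σ_i (R⁻¹e_a)_i (J_i u)(R⁻¹x))` — the generators transform
among themselves by the (pseudo-)adjoint action. No differentiability hypothesis (both sides use
the same junk derivative). [folklore] -/
theorem angGen_conj_linearIsometryEquiv
    (R : EuclideanSpace ℝ (Fin 3) ≃ₗᵢ[ℝ] EuclideanSpace ℝ (Fin 3))
    (u : EuclideanSpace ℝ (Fin 3) → EuclideanSpace ℝ (Fin 3)) (a : Fin 3)
    (x : EuclideanSpace ℝ (Fin 3)) :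
    angGen a (fun y => R (u (R.symm y))) x =
      (R : EuclideanSpace ℝ (Fin 3) →L[ℝ] EuclideanSpace ℝ (Fin 3)).det •
        R (∑ i : Fin 3, (R.symm (axis a)) i • angGen i u (R.symm x)) := by
  rw [sum_smul_angGen, angGen, fderiv_conj_linearIsometryEquiv]
  simp only [ContinuousLinearMap.comp_apply, LinearIsometryEquiv.coe_coe'']
  rw [cross_map_right R (axis a) (u (R.symm x)), symm_cross_eq R (axis a) x, map_smul,
    map_sub, smul_sub, LinearIsometryEquiv.map_smul]

/-- `J_a` of a finite linear combination of differentiable fields. [folklore] -/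
theorem angGen_sum_smul {ι : Type*} (s : Finset ι) (c : ι → ℝ)
    {w : ι → EuclideanSpace ℝ (Fin 3) → EuclideanSpace ℝ (Fin 3)}
    (hw : ∀ i ∈ s, Differentiable ℝ (w i)) (a : Fin 3) :
    angGen a (fun x => ∑ i ∈ s, c i • w i x) = fun x => ∑ i ∈ s, c i • angGen a (w i) x := by
  funext x
  have hD : fderiv ℝ (fun x => ∑ i ∈ s, c i • w i x) x = ∑ i ∈ s, c i • fderiv ℝ (w i) x := by
    rw [fderiv_fun_sum (A := fun i y => c i • w i y) fun i hi => ((hw i hi) x).const_smul (c i)]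
    refine Finset.sum_congr rfl fun i hi => ?_
    exact fderiv_const_smul ((hw i hi) x) (c i)
  simp only [angGen_eq, hD, map_sum, map_smul, _root_.sum_apply, _root_.smul_apply, smul_sub,
    Finset.sum_sub_distrib]

/-! ## §3 The Casimir cut commutes with rotations and reflections -/

/-- Orthogonality bookkeeping: for `Mᵀ M = 1`,
`Σ_a Σ_j Σ_i M_{aj} M_{ai} T_{ji} = Σ_i T_{ii}`. [folklore] -/
private theorem sum_sum_sum_orthogonal {V : Type*} [AddCommGroup V] [Module ℝ V]
    {M : Matrix (Fin 3) (Fin 3) ℝ} (hM : Mᵀ * M = 1) (T : Fin 3 → Fin 3 → V) :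
    ∑ a, ∑ j, ∑ i, (M a j * M a i) • T j i = ∑ i, T i i := by
  rw [Finset.sum_comm]
  refine Finset.sum_congr rfl fun j _ => ?_
  rw [Finset.sum_comm]
  have hrow : ∀ i, ∑ a, M a j * M a i = if j = i then 1 else 0 := fun i => by
    have := congrArg (fun N : Matrix (Fin 3) (Fin 3) ℝ => N j i) hM
    simpa [Matrix.mul_apply, Matrix.transpose_apply, Matrix.one_apply] using this
  simp_rw [← Finset.sum_smul, hrow, ite_smul, one_smul, zero_smul, Finset.sum_ite_eq,
    Finset.mem_univ, if_true]

/-- Smoothness of a conjugated smooth field. [folklore] -/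
theorem contDiff_conj_linearIsometryEquiv
    (R : EuclideanSpace ℝ (Fin 3) ≃ₗᵢ[ℝ] EuclideanSpace ℝ (Fin 3)) (hu : ContDiff ℝ ∞ u) :
    ContDiff ℝ ∞ fun y => R (u (R.symm y)) :=
  (R : EuclideanSpace ℝ (Fin 3) →L[ℝ] EuclideanSpace ℝ (Fin 3)).contDiff.comp
    (hu.comp (R.symm : EuclideanSpace ℝ (Fin 3) →L[ℝ] EuclideanSpace ℝ (Fin 3)).contDiff)

/-- **The Casimir commutes with conjugation by linear isometries** (smooth `u`):
`𝒞(R ∘ u ∘ R⁻¹) = R ∘ (𝒞u) ∘ R⁻¹`. [folklore] -/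
theorem casimir_conj_linearIsometryEquiv
    (R : EuclideanSpace ℝ (Fin 3) ≃ₗᵢ[ℝ] EuclideanSpace ℝ (Fin 3)) (hu : ContDiff ℝ ∞ u) :
    casimir (fun y => R (u (R.symm y))) = fun x => R (casimir u (R.symm x)) := by
  have hσσ : (R : EuclideanSpace ℝ (Fin 3) →L[ℝ] EuclideanSpace ℝ (Fin 3)).det *
      (R : EuclideanSpace ℝ (Fin 3) →L[ℝ] EuclideanSpace ℝ (Fin 3)).det = 1 :=
    det_linearIsometryEquiv_mul_self R
  set M := LinearMap.toMatrixOrthonormal (EuclideanSpace.basisFun (Fin 3) ℝ)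
    ((R : EuclideanSpace ℝ (Fin 3) →L[ℝ] EuclideanSpace ℝ (Fin 3)) :
      EuclideanSpace ℝ (Fin 3) →ₗ[ℝ] EuclideanSpace ℝ (Fin 3)) with hM
  have hMM : Mᵀ * M = 1 := toMatrixOrthonormal_transpose_mul_eq_one R
  -- the coefficients `(R⁻¹ e_a)_i = M_{ai}`
  have hc : ∀ a i : Fin 3, (R.symm (axis a)) i = M a i := fun a i => by
    have h1 := Literature.Analysis.Calculus.toMatrixOrthonormal_basisFun_apply
      (R.symm : EuclideanSpace ℝ (Fin 3) →L[ℝ] EuclideanSpace ℝ (Fin 3)) i a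
    rw [toMatrixOrthonormal_symm_eq_transpose, Matrix.transpose_apply] at h1
    rw [← hM] at h1
    rw [h1]
    rfl
  have hJd : ∀ i, Differentiable ℝ (angGen i u) := fun i =>
    (contDiff_angGen hu i).differentiable (by simp)
  have key : ∀ a x, angGen a (angGen a (fun y => R (u (R.symm y)))) x =
      R (∑ j, ∑ i, (M a j * M a i) • angGen j (angGen i u) (R.symm x)) := by
    intro a x
    -- step 1: the inner generator is the conjugate of a linear combination of the `J_i u`
    have h1 : angGen a (fun y => R (u (R.symm y))) = fun y =>
        R (∑ i, ((R : EuclideanSpace ℝ (Fin 3) →L[ℝ] EuclideanSpace ℝ (Fin 3)).det * M a i) •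
          angGen i u (R.symm y)) := by
      funext y
      rw [angGen_conj_linearIsometryEquiv, ← LinearIsometryEquiv.map_smul, Finset.smul_sum]
      simp only [hc, smul_smul]
    -- step 2: conjugate again
    have h2 := angGen_conj_linearIsometryEquiv R
      (fun z => ∑ i, ((R : EuclideanSpace ℝ (Fin 3) →L[ℝ] EuclideanSpace ℝ (Fin 3)).det * M a i) •
        angGen i u z) a x
    -- step 3: the generator of the linear combination
    have h3 : ∀ j, angGen j (fun z => ∑ i,
        ((R : EuclideanSpace ℝ (Fin 3) →L[ℝ] EuclideanSpace ℝ (Fin 3)).det * M a i) •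
          angGen i u z) =
        fun z => ∑ i, ((R : EuclideanSpace ℝ (Fin 3) →L[ℝ] EuclideanSpace ℝ (Fin 3)).det * M a i) •
          angGen j (angGen i u) z := fun j =>
      angGen_sum_smul Finset.univ
        (fun i => (R : EuclideanSpace ℝ (Fin 3) →L[ℝ] EuclideanSpace ℝ (Fin 3)).det * M a i)
        (fun i _ => hJd i) j
    rw [h1, h2]
    simp only [h3, hc, Finset.smul_sum, smul_smul, ← LinearIsometryEquiv.map_smul]
    congr 1
    refine Finset.sum_congr rfl fun j _ => Finset.sum_congr rfl fun i _ => ?_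
    congr 1
    linear_combination (M a j * M a i) * hσσ
  funext x
  simp only [casimir, key, ← map_sum, ← map_neg]
  congr 1
  rw [sum_sum_sum_orthogonal hMM (fun j i => angGen j (angGen i u) (R.symm x))]

/-- **Every band defect commutes with conjugation by linear isometries** (smooth `u`).
[folklore] -/
theorem bandDefect_conj_linearIsometryEquiv
    (R : EuclideanSpace ℝ (Fin 3) ≃ₗᵢ[ℝ] EuclideanSpace ℝ (Fin 3)) (hu : ContDiff ℝ ∞ u) (L : ℕ) :
    bandDefect L (fun y => R (u (R.symm y))) = fun x => R (bandDefect L u (R.symm x)) := by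
  induction L with
  | zero => exact casimir_conj_linearIsometryEquiv R hu
  | succ L ih =>
      funext x
      change casimir (bandDefect L fun y => R (u (R.symm y))) x -
          (((L : ℝ) + 1) * ((L : ℝ) + 2)) • bandDefect L (fun y => R (u (R.symm y))) x =
        R (casimir (bandDefect L u) (R.symm x) -
          (((L : ℝ) + 1) * ((L : ℝ) + 2)) • bandDefect L u (R.symm x))
      rw [ih, casimir_conj_linearIsometryEquiv R (contDiff_bandDefect hu L), map_sub,
        LinearIsometryEquiv.map_smul]

/-- **Band-limitedness is invariant under rotations and reflections about the centre**: for a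
linear isometry `R` of `ℝ³`, `u` band-limited of degree `≤ L` ⇒ `R ∘ u ∘ R⁻¹` band-limited of
degree `≤ L`. [folklore] -/
theorem IsBandLimited.conj_linearIsometryEquiv (hu : IsBandLimited L u)
    (R : EuclideanSpace ℝ (Fin 3) ≃ₗᵢ[ℝ] EuclideanSpace ℝ (Fin 3)) :
    IsBandLimited L fun y => R (u (R.symm y)) := by
  refine ⟨contDiff_conj_linearIsometryEquiv R hu.1, fun x => ?_⟩
  rw [bandDefect_conj_linearIsometryEquiv R hu.1]
  simp only [hu.2 (R.symm x), map_zero]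

/-- A conjugated compactly supported field has compact support. [folklore] -/
theorem hasCompactSupport_conj_linearIsometryEquiv
    (R : EuclideanSpace ℝ (Fin 3) ≃ₗᵢ[ℝ] EuclideanSpace ℝ (Fin 3))
    {ψ : EuclideanSpace ℝ (Fin 3) → EuclideanSpace ℝ (Fin 3)} (hψ : HasCompactSupport ψ) :
    HasCompactSupport fun y => R (ψ (R.symm y)) := by
  have h1 : HasCompactSupport fun y => ψ (R.symm y) := hψ.comp_homeomorph R.symm.toHomeomorph
  exact h1.comp_left (map_zero R)

/-- **Co-band-limitedness is invariant under rotations and reflections about the centre**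
(isometries preserve Lebesgue measure, and `⟪R g, ψ⟫ = ⟪g, R⁻¹ψ⟫`). [folklore] -/
theorem IsCobandLimited.conj_linearIsometryEquiv (hg : IsCobandLimited L g)
    (R : EuclideanSpace ℝ (Fin 3) ≃ₗᵢ[ℝ] EuclideanSpace ℝ (Fin 3)) :
    IsCobandLimited L fun y => R (g (R.symm y)) := by
  intro ψ hψ hψc
  -- the test field pulled back by `R`
  have hψ' : IsBandLimited L fun y => R.symm (ψ (R.symm.symm y)) :=
    hψ.conj_linearIsometryEquiv R.symm
  have hψc' : HasCompactSupport fun y => R.symm (ψ (R.symm.symm y)) :=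
    hasCompactSupport_conj_linearIsometryEquiv R.symm hψc
  have key := hg _ hψ' hψc'
  simp only [LinearIsometryEquiv.symm_symm] at key
  -- change variables `x = R y`
  have hcv := (R.measurePreserving).integral_comp R.toHomeomorph.measurableEmbedding
    (fun x => ⟪R (g (R.symm x)), ψ x⟫)
  rw [← hcv]
  simp only [LinearIsometryEquiv.symm_apply_apply]
  have hin : ∀ y, ⟪R (g y), ψ (R y)⟫ = ⟪g y, R.symm (ψ (R y))⟫ := fun y => by
    rw [← R.inner_map_map (g y) (R.symm (ψ (R y))), LinearIsometryEquiv.apply_symm_apply]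
  simp only [hin, key]

/-! ## §4 Every rung keeps the rotation symmetry of Navier–Stokes -/

/-- **Rung solutions are covariant under rotations and reflections about the centre**: if
`(u, p, d)` is a rung-`L` solution on a time set `S` of unique differentiability (viscosity `ν`),
then so is `(R ∘ u ∘ R⁻¹, p ∘ R⁻¹, R ∘ d ∘ R⁻¹)` for every linear isometry `R` of `ℝ³` — classical
part by the tree's `IsClassicalNSSolutionOn.conj_linearIsometryEquiv` (Majda–Bertozzi Prop. 1.1
(iii) with force), band- and co-band-limitedness of the slices by §3.
[cite: MajdaBertozziCUP2002, §1.2 Prop. 1.1] -/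
theorem IsRungSolutionOn.conj_linearIsometryEquiv {S : Set ℝ} {ν : ℝ}
    {v : ℝ → EuclideanSpace ℝ (Fin 3) → EuclideanSpace ℝ (Fin 3)}
    {p : ℝ → EuclideanSpace ℝ (Fin 3) → ℝ}
    {d : ℝ → EuclideanSpace ℝ (Fin 3) → EuclideanSpace ℝ (Fin 3)}
    (h : IsRungSolutionOn S ν L v p d) (hS : UniqueDiffOn ℝ S)
    (R : EuclideanSpace ℝ (Fin 3) ≃ₗᵢ[ℝ] EuclideanSpace ℝ (Fin 3)) :
    IsRungSolutionOn S ν L (fun t x => R (v t (R.symm x))) (fun t x => p t (R.symm x))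
      (fun t x => R (d t (R.symm x))) :=
  ⟨h.1.conj_linearIsometryEquiv R hS, fun t ht => (h.2.1 t ht).conj_linearIsometryEquiv R,
    fun t ht => (h.2.2 t ht).conj_linearIsometryEquiv R⟩

/-- The ancient case: on `(−∞, 0)` (a set of unique differentiability) every rotation or
reflection of a rung-`L` solution about the centre is a rung-`L` solution. [folklore] -/
theorem IsRungSolutionOn.conj_linearIsometryEquiv_Iio {ν : ℝ}
    {v : ℝ → EuclideanSpace ℝ (Fin 3) → EuclideanSpace ℝ (Fin 3)}
    {p : ℝ → EuclideanSpace ℝ (Fin 3) → ℝ}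
    {d : ℝ → EuclideanSpace ℝ (Fin 3) → EuclideanSpace ℝ (Fin 3)}
    (h : IsRungSolutionOn (Iio 0) ν L v p d)
    (R : EuclideanSpace ℝ (Fin 3) ≃ₗᵢ[ℝ] EuclideanSpace ℝ (Fin 3)) :
    IsRungSolutionOn (Iio 0) ν L (fun t x => R (v t (R.symm x))) (fun t x => p t (R.symm x))
      (fun t x => R (d t (R.symm x))) :=
  h.conj_linearIsometryEquiv (uniqueDiffOn_Iio 0) R

end AngularLadder

end Summit.NavierStokesRegularity.FluidComputer

end
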